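import HarnessLib
import Summits.QuantumFields.YangMills.Theses.MirrorModularBoosts
import Summits.QuantumFields.YangMills.Theses.ScalingWindowSplit
import Summits.QuantumFields.YangMills.Theorems.MirrorModularBoostsHypercubicLimitOfWeakCoupling
import Summits.QuantumFields.YangMills.Theorems.MirrorModularBoostsHypercubicLimitOfScalingWindowSplit
import Summits.QuantumFields.YangMills.Theorems.CoincidenceRotationBootstrapHypercubicLimitOneFieldWeak
import Summits.QuantumFields.YangMills.Theorems.GronwallGapContinuumFromLatticeGapOneFieldLocal

/-!
# Line `conditional-mean-telescoping` for crux `HypercubicLimit` (stmt-QuantumFields-8646) — RESHAPE 7 (c16 seat)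

Skeleton of the line, c16 seat `prover-line-stmt-QuantumFields-8646-c16-0`, 2026-08-17 (supersedes reshape 6 of the c15 seat,
sha b351eca5…, ONE sorry = the disjoint RP core H16 `stub_rpCoreDisjoint`).  The crux decl concluded BY NAME is the only surviving
copy of item 8646, `Summit.QuantumFields.YangMills.Theses.MirrorModularBoosts.HypercubicLimit` (an `aside` of route
MirrorModularBoosts since rev 17/18; implied by its weak-coupling twin stmt-QuantumFields-16154 through p147954).

## Why reshape 7 (what the c16 seat found)

Reshape 6 registered the heart H16 (character-identical to the registered hearts of 16154 / 16120).  H16 asks, for SOME scheme at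
weak coupling, the RP-spectral clustering clause `RPSpectral r sch Δ C` over the spatially GLOBAL time-slab class (bounded measurable
`Y` depending on the edges of the time slab `[1, T]`, NO spatial restriction, `Y` chosen after the torus size).  That is exactly the
clause for which W₁ = `ScalingWindowSplit.GapAtCorrelationLength` (stmt-18927) was judged refuted-MISSTATED: the landed
`GapAtCorrelationLength_false_of_PersistentSlabCorrelation` (`Theorems/GapAtCorrelationLength/Negative/…`) uses ONLY weak coupling,
`0 < Δ` and the global RP-spectral conjunct — all three present in H16.  Hence, verbatim by the same bookkeeping,
`PersistentSlabCorrelation → ¬ H16` (landed by this seat as `Theorems/HypercubicLimit/Negative/RpCoreDisjointFalseOfPersistentSlabCorrelation.lean`,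
`rpCoreDisjoint_false_of_PersistentSlabCorrelation`): the registered heart of three cruxes is dead modulo the hypothesis H that is
physics-grade expected at the admissible centre-free group `G = SO(3)` (light `ℤ₂` flux; `isCompactSimpleLieGroup_SO3`).  The repair
is known and certified: the r1 redirect strategist of this crux (`STRATEGY-CENSUS.md`, `SPLIT-r1.md`, `SplitGlue_r1.lean`) split the
twin onto the REPAIRED lattice triple — W₁ᴸ (RP-spectral clause over the LOCAL slab class `|x_i| ≤ R`, `2(R+1) ≤ S₀`, exactly the
hypothesis of the landed local seam `ContinuumFromLatticeGap.oneField_of_latticeInequalities_local`), U_RS (`IsCompactSimpleLieGroup G →`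
inserted; the unrepaired U_R is held by the masked-sector obstruction), W₂ᴳ (stmt-18170, unchanged).  Reshape 7 registers exactly
that triple as the stubs of 8646, so the registry of 8646 (i) no longer hangs on a statement refuted modulo H, and (ii) coincides,
statement for statement, with the prepared children of the CRB split / the pending ScalingWindowSplit restates (COORD notes on
18927 / 18014) — whichever files them first, the items ARE these stubs.

## Composition (kernel-checked here; every non-stub arrow is a tree theorem or the 8-line certified glue)

  `stub_gapAtCorrelationLengthLocal` (W₁ᴸ, OPEN)  ─┐
  `stub_selfNormalisedMomentBoundsRS` (U_RS, OPEN) ─┼─ `weakCouplingTwin_of_stubs` (= SplitGlue_r1 `HypercubicLimit_of_subs`; landed for 8646 as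
  `stub_selfNormalisedSkewnessGapped` (W₂ᴳ, OPEN)  ─┘   `Theorems/MirrorModularBoostsHypercubicLimitOfRepairedTriple.lean`, this seat)
        ⇒ `CoincidenceRotationBootstrap.HypercubicLimit` (item 16154)
        ── `hypercubicLimit_of_coincidenceRotationBootstrap` (p147954) ⇒ `MirrorModularBoosts.HypercubicLimit` (item 8646) BY NAME.
  Cross-checks with NO sorry in their cone (§3): stub 3 is `Iff.rfl` the ScalingWindowSplit route decl (item 18170); the CURRENT SWS items
  W₁ / U_R imply stubs 1 / 2 (pure weakenings), so `hypercubicLimit_of_scalingWindowSplit` (p167242) factors through this skeleton.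

## Stubs (the ONLY sorries) — texts = `SPLIT-r1.md` children.json with the leading `let E := EuclideanSpace ℝ (Fin 4)` substituted in
(a top-level `let` in a theorem statement leaks its variable when the statement is USED; the substituted texts are `Iff.rfl` to the
filed ones and to their authoring decls `Cruxes/GapAtCorrelationLength/RestateKit.lean :: GapAtCorrelationLengthLocal`,
`Cruxes/SelfNormalisedMomentBoundsR/MaskedSectorObstruction.lean :: Strategist.SelfNormalisedMomentBoundsRS` — checked in the seat's
`work/RepairedTripleIdentity.lean`, rc 0).
* `stub_gapAtCorrelationLengthLocal` — W₁ᴸ (IR, lattice-only, renormalisation-free): OPEN BY NATURE (weak-coupling volume-uniform lattice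
  mass gap for compact simple G, Chatterjee Problem 5.1 in sequence form).  Supplier: the restate of stmt-18927 / CRB split child 1.
* `stub_selfNormalisedMomentBoundsRS` — U_RS (UV, k-uniform n!-moment bounds for the self-normalised plaquette field, simple G): OPEN
  (observable-level Bałaban; line `Sketch_RS` of stmt-18014 has 8/9 stubs landed, open `stub_clusterBoundSlack`).  Supplier: restate of 18014.
* `stub_selfNormalisedSkewnessGapped` — W₂ᴳ (κ₃ floor at one scale) = item stmt-18170 verbatim (`Iff.rfl`, §3); registered line
  `quartic-uv-transfer` (BC3 PASS).  Supplier: 18170 (`SelfNormalisedSkewnessGapped_holds`).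

Landed pieces this file consumes: p147954, `OneFieldWeak.hypercubicLimit_iff_oneFieldWeak`, `ContinuumFromLatticeGap.oneField_of_latticeInequalities_local`,
p167242 (cross-check).  Dead registered statements (census): reshape 6's H16 — refuted modulo `PersistentSlabCorrelation` (this seat).
-/

noncomputable section

open scoped SchwartzMap
open MeasureTheory Filter Topology
open Literature.MathematicalPhysics.AQFT Literature.MathematicalPhysics.QuantumLattice
open Literature.MathematicalPhysics.QuantumFieldTheory

namespace Summit.QuantumFields.YangMills.Cruxes.HypercubicLimit.ConditionalMeanTelescoping

/-! ## §1 The registered stubs (the ONLY sorries): the repaired lattice triple W₁ᴸ / U_RS / W₂ᴳ -/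

/-- **stub W₁ᴸ — `GapAtCorrelationLengthLocal` (OPEN; IR, lattice-only)**: for every compact simple `G` a faithful `r`, a Wilson scheme
AT WEAK COUPLING with polynomial volumes, `Δ > 0`, `C`, the volume-uniform lattice gap `HasLatticeMassGap r sch Δ`, its RP-spectral form
over the LOCAL slab class, and one past-supported bump `u`, `p`, `M` with eventually the floor `a_k^p ≤ T⁰_k(u,θu)` and the one-step
window.  Text = `SPLIT-r1.md` child 1 = `RestateKit.GapAtCorrelationLengthLocal` (`let E` substituted). -/
theorem stub_gapAtCorrelationLengthLocal :
    ∀ (G : Type) [Group G] [TopologicalSpace G] [IsTopologicalGroup G] [CompactSpace G], IsCompactSimpleLieGroup G → letI : MeasurableSpace G := borel G; haveI : BorelSpace G := ⟨rfl⟩; ∃ (r : LatticeRep G) (sch : SpeciesScheme (YMSpecies G)) (u : SchwartzMap (EuclideanSpace ℝ (Fin 4)) ℝ) (p : ℕ) (M Δ C : ℝ), let bare : SpeciesScheme (YMSpecies G) := { sch with c := fun _ _ => 1, m := fun _ _ => 0 }; let T : SchwartzMap (EuclideanSpace ℝ (Fin 4)) ℝ → ℕ → ℝ := fun w k => latticeSchwinger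 r.ρ bare (fun s => s.F) k (1 + 1) (fun _ => r.curvature) ![w, thetaTest 4 w] - latticeSchwinger r.ρ bare (fun s => s.F) k 1 (fun _ => r.curvature) ![w] * latticeSchwinger r.ρ bare (fun s => s.F) k 1 (fun _ => r.curvature) ![thetaTest 4 w]; sch.HasWeakCouplingLimit ∧ (∃ N : ℕ, 1 ≤ N ∧ ∀ᶠ k in Filter.atTop, (sch.a k)⁻¹ ≤ (sch.a k * (sch.L k : ℝ)) ^ N) ∧ 0 < Δ ∧ HasLatticeMassGap r sch Δ ∧ (∀ᶠ k in Filter.atTop, ∀ (S₀ T₀ n R : ℕ), sch.L k ≤ S₀ → 2 * (T₀ + n + 1) ≤ S₀ → 2 * (R + 1) ≤ S₀ → ∀ (Y : LGConfig 4 G → ℝ) (B : ℝ), Measurable Y → (∀ U, |Y U| ≤ B) → DependsOn Y {e : Literature.MathematicalPhysics.QuantumLattice.ZdEdge 4 | (1 ≤ e.1 0 ∧ e.1 0 + (if e.2 = 0 then 1 else 0) ≤ T₀) ∧ ∀ i : Fin 4, i ≠ 0 → |e.1 i| ≤ R} → |(∫ U, Y (torusLift (2 * S₀ + 1) (GaugeConfig.timeReflect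 U)) * Y (configShift (-Pi.single 0 (n : ℤ)) (torusLift (2 * S₀ + 1) U)) ∂(wilsonMeasure r.ρ (sch.β k) : Measure (GaugeConfig 4 (2 * S₀ + 1) G))) - (∫ U, Y (torusLift (2 * S₀ + 1) U) ∂(wilsonMeasure r.ρ (sch.β k) : Measure (GaugeConfig 4 (2 * S₀ + 1) G))) ^ 2| ≤ Real.exp (-(Δ * sch.a k * n)) * ((∫ U, Y (torusLift (2 * S₀ + 1) (GaugeConfig.timeReflect U)) * Y (torusLift (2 * S₀ + 1) U) ∂(wilsonMeasure r.ρ (sch.β k) : Measure (GaugeConfig 4 (2 * S₀ + 1) G))) - (∫ U, Y (torusLift (2 * S₀ + 1) U) ∂(wilsonMeasure r.ρ (sch.β k) : Measure (GaugeConfig 4 (2 * S₀ + 1) G))) ^ 2) + C * B ^ 2 * Real.exp (-(Δ * sch.a k * S₀))) ∧ tsupport u ⊆ {y : (EuclideanSpace ℝ (Fin 4)) | y 0 < 0} ∧ ∀ᶠ k in Filter.atTop, (sch.a k) ^ p ≤ T u k ∧ T u k ≤ M * T (timeShiftTest 4 (-1) u) k := by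
  sorry

/-- **stub U_RS — `SelfNormalisedMomentBoundsRS` (OPEN; UV)**: for every compact SIMPLE `G`, faithful `r`, scheme at weak coupling with
polynomial volumes, past-supported bump `u`, `p`, `M` with floor and window, the plane-resolved smeared plaquette fields of the
SELF-NORMALISED scheme obey k-uniform factorial moment bounds on normalised, pairwise plane-wise disjoint tuples.
Text = `SPLIT-r1.md` child 2 = `Strategist.SelfNormalisedMomentBoundsRS` (`let E` substituted). -/
theorem stub_selfNormalisedMomentBoundsRS :
    ∀ (G : Type) [Group G] [TopologicalSpace G] [IsTopologicalGroup G] [CompactSpace G] [MeasurableSpace G] [BorelSpace G], IsCompactSimpleLieGroup G → ∀ (r : LatticeRep G) (sch : SpeciesScheme (YMSpecies G)) (u : SchwartzMap (EuclideanSpace ℝ (Fin 4)) ℝ) (p : ℕ) (M : ℝ), let bare : SpeciesScheme (YMSpecies G) := { sch with c := fun _ _ => 1, m := fun _ _ => 0 }; let T : SchwartzMap (EuclideanSpace ℝ (Fin 4)) ℝ → ℕ → ℝ := fun w k => latticeSchwinger r.ρ bare (fun s => s.F) k (1 + 1) (fun _ => r.curvature) ![w, thetaTest 4 w] - latticeSchwinger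 r.ρ bare (fun s => s.F) k 1 (fun _ => r.curvature) ![w] * latticeSchwinger r.ρ bare (fun s => s.F) k 1 (fun _ => r.curvature) ![thetaTest 4 w]; let canon : SpeciesScheme (YMSpecies G) := { sch with c := fun _ k => (Real.sqrt (T u k))⁻¹, m := fun _ k => ∫ U, r.curvature.F (torusLift (sch.side k) U) ∂(wilsonMeasure r.ρ (sch.β k)) }; sch.HasWeakCouplingLimit → (∃ N : ℕ, 1 ≤ N ∧ ∀ᶠ k in Filter.atTop, (sch.a k)⁻¹ ≤ (sch.a k * (sch.L k : ℝ)) ^ N) → tsupport u ⊆ {y : (EuclideanSpace ℝ (Fin 4)) | y 0 < 0} → (∀ᶠ k in Filter.atTop, (sch.a k) ^ p ≤ T u k ∧ T u k ≤ M * T (timeShiftTest 4 (-1) u) k) → ∃ (s : ℕ) (C₀ C₁ : ℝ), ∀ (n : ℕ) (F : Fin n → {q : Fin 4 × Fin 4 // q.1 < q.2} → SchwartzMap (EuclideanSpace ℝ (Fin 4)) ℝ), (∀ i, ∑ q, schwartzNorm s (ofRealTest (F i q)) ≤ 1) → (∀ i j, i ≠ j → ∀ q q', Disjoint (tsupport (F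 i q)) (tsupport (F j q'))) → ∀ k : ℕ, |∫ U, ∏ i, ∑ q : {q : Fin 4 × Fin 4 // q.1 < q.2}, smearedLatticeField (plaquetteObs r.ρ 0 q.1.1 q.1.2) (Literature.Probability.LatticeModels.box 4 (canon.L k)) (canon.a k) (canon.c r.curvature k) (canon.m r.curvature k / 6) (F i q) (torusLift (canon.side k) U) ∂(wilsonMeasure r.ρ (canon.β k) : Measure (GaugeConfig 4 (canon.side k) G))| ≤ C₀ * C₁ ^ n * n.factorial := by
  sorry

/-- **stub W₂ᴳ — `SelfNormalisedSkewnessGapped` (OPEN; non-Gaussianity floor at one scale)** = item stmt-QuantumFields-18170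
(`ScalingWindowSplit.SelfNormalisedSkewnessGapped`, `Iff.rfl` — §3).  Text = `SPLIT-r1.md` child 3 (`let E` substituted). -/
theorem stub_selfNormalisedSkewnessGapped :
    ∀ (G : Type) [Group G] [TopologicalSpace G] [IsTopologicalGroup G] [CompactSpace G] [MeasurableSpace G] [BorelSpace G] (r : LatticeRep G) (sch : SpeciesScheme (YMSpecies G)) (u : SchwartzMap (EuclideanSpace ℝ (Fin 4)) ℝ) (p : ℕ) (M Δ : ℝ), let bare : SpeciesScheme (YMSpecies G) := { sch with c := fun _ _ => 1, m := fun _ _ => 0 }; let T : SchwartzMap (EuclideanSpace ℝ (Fin 4)) ℝ → ℕ → ℝ := fun w k => latticeSchwinger r.ρ bare (fun s => s.F) k (1 + 1) (fun _ => r.curvature) ![w, thetaTest 4 w] - latticeSchwinger r.ρ bare (fun s => s.F) k 1 (fun _ => r.curvature) ![w] * latticeSchwinger r.ρ bare (fun s => s.F) k 1 (fun _ => r.curvature) ![thetaTest 4 w]; let canon : SpeciesScheme (YMSpecies G) := { sch with c := fun _ k => (Real.sqrt (T u k))⁻¹, m := fun _ k => ∫ U, r.curvature.F (torusLift (sch.side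 k) U) ∂(wilsonMeasure r.ρ (sch.β k)) }; sch.HasWeakCouplingLimit → 0 < Δ → HasLatticeMassGap r sch Δ → (∃ N : ℕ, 1 ≤ N ∧ ∀ᶠ k in Filter.atTop, (sch.a k)⁻¹ ≤ (sch.a k * (sch.L k : ℝ)) ^ N) → tsupport u ⊆ {y : (EuclideanSpace ℝ (Fin 4)) | y 0 < 0} → (∀ᶠ k in Filter.atTop, (sch.a k) ^ p ≤ T u k ∧ T u k ≤ M * T (timeShiftTest 4 (-1) u) k) → ∃ (f g h : SchwartzMap (EuclideanSpace ℝ (Fin 4)) ℝ) (δ : ℝ), Disjoint (tsupport f) (tsupport g) ∧ Disjoint (tsupport f) (tsupport h) ∧ Disjoint (tsupport g) (tsupport h) ∧ 0 < δ ∧ ∀ᶠ k in Filter.atTop, δ ≤ |latticeSchwinger r.ρ canon (fun s => s.F) k 3 (fun _ => r.curvature) ![f, g, h] - latticeSchwinger r.ρ canon (fun s => s.F) k 1 (fun _ => r.curvature) ![f] * latticeSchwinger r.ρ canon (fun s => s.F) k 2 (fun _ => r.curvature) ![g, h] - latticeSchwinger r.ρ canon (fun s => s.F) k 1 (fun _ =>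 r.curvature) ![g] * latticeSchwinger r.ρ canon (fun s => s.F) k 2 (fun _ => r.curvature) ![f, h] - latticeSchwinger r.ρ canon (fun s => s.F) k 1 (fun _ => r.curvature) ![h] * latticeSchwinger r.ρ canon (fun s => s.F) k 2 (fun _ => r.curvature) ![f, g] + 2 * (latticeSchwinger r.ρ canon (fun s => s.F) k 1 (fun _ => r.curvature) ![f] * latticeSchwinger r.ρ canon (fun s => s.F) k 1 (fun _ => r.curvature) ![g] * latticeSchwinger r.ρ canon (fun s => s.F) k 1 (fun _ => r.curvature) ![h])| := by
  sorry

/-! ## §2 The composition: the crux BY NAME from the three stubs -/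

/-- **The repaired split's glue, twin form** (= the r1 strategist's certified `SplitGlue_r1.lean :: HypercubicLimit_of_subs`; landed for
8646 as `Theorems.HypercubicLimit.weakCouplingHypercubicLimit_of_repairedTriple`, this seat): the three stubs ⇒
`CoincidenceRotationBootstrap.HypercubicLimit` (item 16154).  Per compact simple `G` take W₁ᴸ's witness and apply the landed LOCAL seam,
feeding U_RS the consumer's simplicity hypothesis. [cite: GlimmJaffe1987, §6.1 and §19.1] -/
theorem weakCouplingTwin_of_stubs :
    Summit.QuantumFields.YangMills.Theses.CoincidenceRotationBootstrap.HypercubicLimit := by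
  refine Summit.QuantumFields.YangMills.Theorems.HypercubicLimit.OneFieldWeak.hypercubicLimit_iff_oneFieldWeak.mpr
    fun G _ _ _ _ hG => ?_
  letI : MeasurableSpace G := borel G
  haveI : BorelSpace G := ⟨rfl⟩
  obtain ⟨r, sch, u, p, M, Δ, C, hw, hpv, hΔ, hgap, hrp, hu, hfw⟩ := stub_gapAtCorrelationLengthLocal G hG
  obtain ⟨sch', S₁, hw', h₁⟩ :=
    Summit.QuantumFields.YangMills.Theorems.ContinuumFromLatticeGap.oneField_of_latticeInequalities_local
      r sch u p M Δ C hw hpv hΔ hgap hrp hu hfw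
      (stub_selfNormalisedMomentBoundsRS G hG r sch u p M hw hpv hu hfw)
      (stub_selfNormalisedSkewnessGapped G r sch u p M Δ hw hΔ hgap hpv hu hfw)
  exact ⟨r, sch', S₁, hw', h₁⟩

/-- **Registered target of the skeleton** (checker convention `<Crux>_proof`): the crux in the ONLY route file still declaring item
stmt-QuantumFields-8646, `MirrorModularBoosts.HypercubicLimit`, from the three registered stubs — the twin glue followed by forgetting
`sch.HasWeakCouplingLimit` (`hypercubicLimit_of_coincidenceRotationBootstrap`, p147954).  No `sorry` of its own. -/
theorem HypercubicLimit_proof :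
    Summit.QuantumFields.YangMills.Theses.MirrorModularBoosts.HypercubicLimit :=
  Summit.QuantumFields.YangMills.Theorems.HypercubicLimit.hypercubicLimit_of_coincidenceRotationBootstrap
    weakCouplingTwin_of_stubs

/-! ## §3 Cross-checks with NO sorry in their cone -/

/-- Stub 3 IS item stmt-QuantumFields-18170 (`ScalingWindowSplit.SelfNormalisedSkewnessGapped`). -/
example : (∀ (G : Type) [Group G] [TopologicalSpace G] [IsTopologicalGroup G] [CompactSpace G] [MeasurableSpace G] [BorelSpace G] (r : LatticeRep G) (sch : SpeciesScheme (YMSpecies G)) (u : SchwartzMap (EuclideanSpace ℝ (Fin 4)) ℝ) (p : ℕ) (M Δ : ℝ), let bare : SpeciesScheme (YMSpecies G) := { sch with c := fun _ _ => 1, m := fun _ _ => 0 }; let T : SchwartzMap (EuclideanSpace ℝ (Fin 4)) ℝ → ℕ → ℝ := fun w k => latticeSchwinger r.ρ bare (fun s => s.F) k (1 + 1) (fun _ => r.curvature) ![w, thetaTest 4 w] - latticeSchwinger r.ρ bare (fun s => s.F) k 1 (fun _ => r.curvature) ![w] * latticeSchwinger r.ρ bare (fun s => s.F) k 1 (fun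 _ => r.curvature) ![thetaTest 4 w]; let canon : SpeciesScheme (YMSpecies G) := { sch with c := fun _ k => (Real.sqrt (T u k))⁻¹, m := fun _ k => ∫ U, r.curvature.F (torusLift (sch.side k) U) ∂(wilsonMeasure r.ρ (sch.β k)) }; sch.HasWeakCouplingLimit → 0 < Δ → HasLatticeMassGap r sch Δ → (∃ N : ℕ, 1 ≤ N ∧ ∀ᶠ k in Filter.atTop, (sch.a k)⁻¹ ≤ (sch.a k * (sch.L k : ℝ)) ^ N) → tsupport u ⊆ {y : (EuclideanSpace ℝ (Fin 4)) | y 0 < 0} → (∀ᶠ k in Filter.atTop, (sch.a k) ^ p ≤ T u k ∧ T u k ≤ M * T (timeShiftTest 4 (-1) u) k) → ∃ (f g h : SchwartzMap (EuclideanSpace ℝ (Fin 4)) ℝ) (δ : ℝ), Disjoint (tsupport f) (tsupport g) ∧ Disjoint (tsupport f) (tsupport h) ∧ Disjoint (tsupport g) (tsupport h) ∧ 0 < δ ∧ ∀ᶠ k in Filter.atTop, δ ≤ |latticeSchwinger r.ρ canon (fun s => s.F) k 3 (fun _ => r.curvature) ![f, g, h] - latticeSchwinger r.ρ canon (fun s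 => s.F) k 1 (fun _ => r.curvature) ![f] * latticeSchwinger r.ρ canon (fun s => s.F) k 2 (fun _ => r.curvature) ![g, h] - latticeSchwinger r.ρ canon (fun s => s.F) k 1 (fun _ => r.curvature) ![g] * latticeSchwinger r.ρ canon (fun s => s.F) k 2 (fun _ => r.curvature) ![f, h] - latticeSchwinger r.ρ canon (fun s => s.F) k 1 (fun _ => r.curvature) ![h] * latticeSchwinger r.ρ canon (fun s => s.F) k 2 (fun _ => r.curvature) ![f, g] + 2 * (latticeSchwinger r.ρ canon (fun s => s.F) k 1 (fun _ => r.curvature) ![f] * latticeSchwinger r.ρ canon (fun s => s.F) k 1 (fun _ => r.curvature) ![g] * latticeSchwinger r.ρ canon (fun s => s.F) k 1 (fun _ => r.curvature) ![h])|) ↔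
    Summit.QuantumFields.YangMills.Theses.ScalingWindowSplit.SelfNormalisedSkewnessGapped := Iff.rfl

/-- The CURRENT W₁ (stmt-18927, global slab class) implies stub 1 (pure weakening: the local class is a subclass). -/
example (h : Summit.QuantumFields.YangMills.Theses.ScalingWindowSplit.GapAtCorrelationLength) :
    ∀ (G : Type) [Group G] [TopologicalSpace G] [IsTopologicalGroup G] [CompactSpace G], IsCompactSimpleLieGroup G → letI : MeasurableSpace G := borel G; haveI : BorelSpace G := ⟨rfl⟩; ∃ (r : LatticeRep G) (sch : SpeciesScheme (YMSpecies G)) (u : SchwartzMap (EuclideanSpace ℝ (Fin 4)) ℝ) (p : ℕ) (M Δ C : ℝ), let bare : SpeciesScheme (YMSpecies G) := { sch with c := fun _ _ => 1, m := fun _ _ => 0 }; let T : SchwartzMap (EuclideanSpace ℝ (Fin 4)) ℝ → ℕ → ℝ := fun w k => latticeSchwinger r.ρ bare (fun s => s.F) k (1 + 1) (fun _ => r.curvature) ![w, thetaTest 4 w] - latticeSchwinger r.ρ bare (fun s => s.F) k 1 (fun _ => r.curvature) ![w] * latticeSchwinger r.ρ bare (fun s => s.F) k 1 (fun _ => r.curvature)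 ![thetaTest 4 w]; sch.HasWeakCouplingLimit ∧ (∃ N : ℕ, 1 ≤ N ∧ ∀ᶠ k in Filter.atTop, (sch.a k)⁻¹ ≤ (sch.a k * (sch.L k : ℝ)) ^ N) ∧ 0 < Δ ∧ HasLatticeMassGap r sch Δ ∧ (∀ᶠ k in Filter.atTop, ∀ (S₀ T₀ n R : ℕ), sch.L k ≤ S₀ → 2 * (T₀ + n + 1) ≤ S₀ → 2 * (R + 1) ≤ S₀ → ∀ (Y : LGConfig 4 G → ℝ) (B : ℝ), Measurable Y → (∀ U, |Y U| ≤ B) → DependsOn Y {e : Literature.MathematicalPhysics.QuantumLattice.ZdEdge 4 | (1 ≤ e.1 0 ∧ e.1 0 + (if e.2 = 0 then 1 else 0) ≤ T₀) ∧ ∀ i : Fin 4, i ≠ 0 → |e.1 i| ≤ R} → |(∫ U, Y (torusLift (2 * S₀ + 1) (GaugeConfig.timeReflect U)) * Y (configShift (-Pi.single 0 (n : ℤ)) (torusLift (2 * S₀ + 1) U)) ∂(wilsonMeasure r.ρ (sch.β k) : Measure (GaugeConfig 4 (2 * S₀ + 1) G))) - (∫ U, Y (torusLift (2 * S₀ +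 1) U) ∂(wilsonMeasure r.ρ (sch.β k) : Measure (GaugeConfig 4 (2 * S₀ + 1) G))) ^ 2| ≤ Real.exp (-(Δ * sch.a k * n)) * ((∫ U, Y (torusLift (2 * S₀ + 1) (GaugeConfig.timeReflect U)) * Y (torusLift (2 * S₀ + 1) U) ∂(wilsonMeasure r.ρ (sch.β k) : Measure (GaugeConfig 4 (2 * S₀ + 1) G))) - (∫ U, Y (torusLift (2 * S₀ + 1) U) ∂(wilsonMeasure r.ρ (sch.β k) : Measure (GaugeConfig 4 (2 * S₀ + 1) G))) ^ 2) + C * B ^ 2 * Real.exp (-(Δ * sch.a k * S₀))) ∧ tsupport u ⊆ {y : (EuclideanSpace ℝ (Fin 4)) | y 0 < 0} ∧ ∀ᶠ k in Filter.atTop, (sch.a k) ^ p ≤ T u k ∧ T u k ≤ M * T (timeShiftTest 4 (-1) u) k := by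
  intro G _ _ _ _ hG
  letI : MeasurableSpace G := borel G
  haveI : BorelSpace G := ⟨rfl⟩
  obtain ⟨r, sch, u, p, M, Δ, C, hw, hpv, hΔ, hgap, hrp, hu, hfw⟩ := h G hG
  refine ⟨r, sch, u, p, M, Δ, C, hw, hpv, hΔ, hgap, ?_, hu, hfw⟩
  filter_upwards [hrp] with k hk S₀ T₀ n R hL h2 _hR Y B hYm hYb hYdep
  exact hk S₀ T₀ n hL h2 Y B hYm hYb (hYdep.mono fun e he => he.1)

/-- The CURRENT U_R (stmt-18014, all compact G) implies stub 2 (restriction to simple G). -/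
example (h : Summit.QuantumFields.YangMills.Theses.ScalingWindowSplit.SelfNormalisedMomentBoundsR) :
    ∀ (G : Type) [Group G] [TopologicalSpace G] [IsTopologicalGroup G] [CompactSpace G] [MeasurableSpace G] [BorelSpace G], IsCompactSimpleLieGroup G → ∀ (r : LatticeRep G) (sch : SpeciesScheme (YMSpecies G)) (u : SchwartzMap (EuclideanSpace ℝ (Fin 4)) ℝ) (p : ℕ) (M : ℝ), let bare : SpeciesScheme (YMSpecies G) := { sch with c := fun _ _ => 1, m := fun _ _ => 0 }; let T : SchwartzMap (EuclideanSpace ℝ (Fin 4)) ℝ → ℕ → ℝ := fun w k => latticeSchwinger r.ρ bare (fun s => s.F) k (1 + 1) (fun _ => r.curvature) ![w, thetaTest 4 w] - latticeSchwinger r.ρ bare (fun s => s.F) k 1 (fun _ => r.curvature) ![w] * latticeSchwinger r.ρ bare (fun s => s.F) k 1 (fun _ => r.curvature) ![thetaTest 4 w]; let canon : SpeciesScheme (YMSpecies G) := { sch with c := fun _ k => (Real.sqrt (T u k))⁻¹, m := fun _ k => ∫ U, r.curvature.F (torusLift (sch.side k) U) ∂(wilsonMeasure r.ρ (sch.β k))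 }; sch.HasWeakCouplingLimit → (∃ N : ℕ, 1 ≤ N ∧ ∀ᶠ k in Filter.atTop, (sch.a k)⁻¹ ≤ (sch.a k * (sch.L k : ℝ)) ^ N) → tsupport u ⊆ {y : (EuclideanSpace ℝ (Fin 4)) | y 0 < 0} → (∀ᶠ k in Filter.atTop, (sch.a k) ^ p ≤ T u k ∧ T u k ≤ M * T (timeShiftTest 4 (-1) u) k) → ∃ (s : ℕ) (C₀ C₁ : ℝ), ∀ (n : ℕ) (F : Fin n → {q : Fin 4 × Fin 4 // q.1 < q.2} → SchwartzMap (EuclideanSpace ℝ (Fin 4)) ℝ), (∀ i, ∑ q, schwartzNorm s (ofRealTest (F i q)) ≤ 1) → (∀ i j, i ≠ j → ∀ q q', Disjoint (tsupport (F i q)) (tsupport (F j q'))) → ∀ k : ℕ, |∫ U, ∏ i, ∑ q : {q : Fin 4 × Fin 4 // q.1 < q.2}, smearedLatticeField (plaquetteObs r.ρ 0 q.1.1 q.1.2) (Literature.Probability.LatticeModels.box 4 (canon.L k)) (canon.a k) (canon.c r.curvature k) (canon.m r.curvature k / 6) (F i q) (torusLift (canon.side k) U) ∂(wilsonMeasure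 r.ρ (canon.β k) : Measure (GaugeConfig 4 (canon.side k) G))| ≤ C₀ * C₁ ^ n * n.factorial :=
  fun G _ _ _ _ _ _ _hG r sch u p M => h G r sch u p M

/-- Reshape 6's composition stays a TREE theorem (p167242): the current SWS triple closes 8646 — consistent with §2 through the two
weakenings above. -/
example : Summit.QuantumFields.YangMills.Theses.ScalingWindowSplit.GapAtCorrelationLength →
    Summit.QuantumFields.YangMills.Theses.ScalingWindowSplit.SelfNormalisedMomentBoundsR →
    Summit.QuantumFields.YangMills.Theses.ScalingWindowSplit.SelfNormalisedSkewnessGapped →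
    Summit.QuantumFields.YangMills.Theses.MirrorModularBoosts.HypercubicLimit :=
  Summit.QuantumFields.YangMills.Theorems.HypercubicLimit.hypercubicLimit_of_scalingWindowSplit

end Summit.QuantumFields.YangMills.Cruxes.HypercubicLimit.ConditionalMeanTelescoping

end
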